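import Literature.AlgebraicGeometry.Motives.CubeOverNoetherianBase
import Literature.AlgebraicGeometry.Morphisms.ClosedImmersionOfInfinitesimalFactorisationsConnected
import Literature.AlgebraicGeometry.Modules.CechPicOfLocalRing
import Literature.AlgebraicGeometry.Modules.DetClassOfIso
import HarnessLib

/-!
# The theorem of the cube over a NON-reduced base, Mumford's form: faces + a SECTION of a base with connected fibres

Layer `Literature/AlgebraicGeometry/Motives`, namespace `Literature.AlgebraicGeometry.Motives`.  THEOREMS ONLY (no definition, no named
fact, no instance, no notation).  Cell `hodgecm-mathlib` (D-0151), F-2d road (R-def) «theorem of the cube over a NON-reduced base», brick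
D5c-γ0′ (author B-p07 (g16)).  ★ γ0 `exists_iso_pullback_snd_of_faces_of_fibres` (`Motives/CubeOverNoetherianBase`) asks the rank-one
`N` on `(X ⊗ Y) ⊗ W` to be trivial on EVERY fibre `(X ⊗ Y) × {t}`; here that hypothesis is replaced by [MumfordAV1970] §6's: `N` is
trivial along a SECTION `w : Spec R → W` of the base and every point of `W` lies in a preconnected subset of `W` through a point of
`w` (e.g. `W → Spec R` with connected fibres).  The seesaw subscheme `i : Z ↪ W` (hypothesis `huniv`, ★ `SeesawRelative.…`) then
contains `w`, and at each of ITS points `t` the `κ(t)`-fibre of `N` is trivial through `huniv` itself (a rank-one module on the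
spectrum of a local ring is trivial, ★ `CechPic.eq_one_of_isLocalRing`), so Step (I) (★ `nonempty_unit_iso_infinitesimal`) makes all
infinitesimal neighbourhoods of the points of `Z` factor through `Z`; ★ D3‴
(`Morphisms/ClosedImmersionOfInfinitesimalFactorisationsConnected`) gives `Z = W`, and ★ γ0 concludes.

* §1 `nonempty_iso_unitModule_of_hasRank_one_of_isLocalRing` — rank one on `Spec` of a local ring is `𝒪`;
  `exists_fac_of_nonempty_unit_iso` — a test object on which `N` is trivial factors through the seesaw subscheme;
  `nonempty_unit_iso_fibre_of_mem_range` — at a point of the seesaw subscheme the fibre of `N` is trivial.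
* §2 **`exists_iso_pullback_snd_of_faces_of_section`** — [MumfordAV1970] §6 Theorem of the cube over a possibly NON-reduced locally
  noetherian `W/R` ([GortzWedhorn2023] Lemma 24.72): faces + section + connected fibres + seesaw ⟹ `N ≅ pr_W^*𝓜`.

HC_CM is proved only modulo the 7 printed citations until rung 0 closes; nothing here is about HC.

## References
* [MumfordAV1970] D. Mumford, *Abelian Varieties* (1970), §6 (theorem of the cube and its proof), §10 (seesaw, p. 89).
* [GortzWedhorn2023] U. Görtz, T. Wedhorn, *Algebraic Geometry II* (2023), Lemma 24.72 (p. 409).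
* [Hartshorne1977] R. Hartshorne, *Algebraic Geometry* (1977), II Ex. 6.8 (Pic of a local ring), III Ex. 4.5.
-/

noncomputable section

universe u

open CategoryTheory CategoryTheory.Limits AlgebraicGeometry MonoidalCategory CartesianMonoidalCategory
open IsLocalRing
open Literature.AlgebraicGeometry.Morphisms Literature.AlgebraicGeometry.Modules
open Literature.AlgebraicGeometry.AbelianSchemes.AbelianSchemeOver
open Literature.AlgebraicGeometry.AbelianVarieties

namespace Literature.AlgebraicGeometry.Motives

variable {R : Type u} [CommRing R]

/-! ## §1 Points of the seesaw subscheme -/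

/-- **A rank-one module on the spectrum of a LOCAL ring is trivial** (Pic of a local ring vanishes, ★ `CechPic.eq_one_of_isLocalRing`;
rank-one modules are classified by their class, ★ `nonempty_iso_iff_detClass_eq`). [cite: Hartshorne1977, II Ex. 6.8 and III Ex. 4.5] -/
theorem nonempty_iso_unitModule_of_hasRank_one_of_isLocalRing {O : CommRingCat.{u}} [IsLocalRing O] (𝓜 : (Spec O).Modules)
    (h : HasRank 𝓜 1) : Nonempty (𝓜 ≅ unitModule (Spec O)) :=
  (nonempty_iso_iff_detClass_eq h hasRank_unitModule (HasRank.isFiniteLocallyFree' h)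
    (HasRank.isFiniteLocallyFree' hasRank_unitModule)).2
    (by rw [CechPic.eq_one_of_isLocalRing (detClass _), CechPic.eq_one_of_isLocalRing (detClass _)])

/-- **A test object on which `N` is trivial factors through the seesaw subscheme** (universality with `𝓜 = 𝒪_T`).
[cite: MumfordAV1970, §10 (p. 89)] -/
theorem exists_fac_of_nonempty_unit_iso (X W : SchemeOver R) (N : (X ⊗ W).left.Modules) {Z : SchemeOver R} (i : Z ⟶ W)
    (huniv : ∀ (S : SchemeOver R) (u : S ⟶ W), (∃ v : S ⟶ Z, v ≫ i = u) ↔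
      ∃ (𝓜 : S.left.Modules) (_ : 𝓜.IsQuasicoherent) (_ : HasRank 𝓜 1),
        Nonempty ((Scheme.Modules.pullback (X ◁ u).left).obj N ≅ (Scheme.Modules.pullback (snd X S).left).obj 𝓜))
    {T : SchemeOver R} (u : T ⟶ W)
    (hT : Nonempty (unitModule (X ⊗ T).left ≅ (Scheme.Modules.pullback (X ◁ u).left).obj N)) :
    ∃ v : T ⟶ Z, v ≫ i = u := by
  obtain ⟨ψ⟩ := hT
  exact (huniv T u).2 ⟨unitModule T.left, isQuasicoherent_of_isAffineLocalizing IsAffineLocalizing.unit, hasRank_unitModule,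
    ⟨ψ.symm ≪≫ (RigidifiedLineBundle.pullbackUnitIso (snd X T).left).symm⟩⟩

/-- **At a point of the seesaw subscheme the fibre of `N` is trivial**: the point `Spec κ(t) → W` factors through `Z` (★
`IsClosedImmersion.exists_fromSpecResidueField_fac`), so `N|_{X × t} ≅ pr^*𝓜` for a rank-one `𝓜` on `Spec κ(t)`, which is `𝒪`.
[cite: MumfordAV1970, §10 (p. 89)] [cite: Hartshorne1977, II Ex. 6.8 and III Ex. 4.5] -/
theorem nonempty_unit_iso_fibre_of_mem_range (X W : SchemeOver R) (N : (X ⊗ W).left.Modules) {Z : SchemeOver R} (i : Z ⟶ W)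
    [IsClosedImmersion i.left]
    (huniv : ∀ (S : SchemeOver R) (u : S ⟶ W), (∃ v : S ⟶ Z, v ≫ i = u) ↔
      ∃ (𝓜 : S.left.Modules) (_ : 𝓜.IsQuasicoherent) (_ : HasRank 𝓜 1),
        Nonempty ((Scheme.Modules.pullback (X ◁ u).left).obj N ≅ (Scheme.Modules.pullback (snd X S).left).obj 𝓜))
    (t : W.left) (ht : t ∈ Set.range i.left.base) :
    Nonempty (unitModule _ ≅ (Scheme.Modules.pullback (X ◁ (Over.homMk (W.left.fromSpecResidueField t) rfl :
      Over.mk (W.left.fromSpecResidueField t ≫ W.hom) ⟶ W)).left).obj N) := by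
  obtain ⟨z, rfl⟩ := ht
  obtain ⟨v, hv⟩ := IsClosedImmersion.exists_fromSpecResidueField_fac i.left z
  have hvZ : v ≫ Z.hom = W.left.fromSpecResidueField (i.left.base z) ≫ W.hom := by rw [← Over.w i, ← Category.assoc, hv]
  obtain ⟨𝓜, -, hr, ⟨e⟩⟩ := (huniv (Over.mk (W.left.fromSpecResidueField (i.left.base z) ≫ W.hom))
    (Over.homMk (W.left.fromSpecResidueField (i.left.base z)) rfl)).1
    ⟨Over.homMk v hvZ, Over.OverMorphism.ext hv⟩
  obtain ⟨j⟩ := nonempty_iso_unitModule_of_hasRank_one_of_isLocalRing 𝓜 hr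
  exact ⟨(e ≪≫ (Scheme.Modules.pullback (snd X _).left).mapIso j ≪≫ RigidifiedLineBundle.pullbackUnitIso (snd X _).left).symm⟩

/-! ## §2 The cube over a base with a section and connected fibres -/

/-- **THE THEOREM OF THE CUBE OVER A (POSSIBLY NON-REDUCED) LOCALLY NOETHERIAN BASE, MUMFORD'S FORM** ([MumfordAV1970] §6;
[GortzWedhorn2023] Lemma 24.72): for `X, Y → Spec R` flat, proper, with geometrically integral fibres, universally Stein, with sections
`x, y` (affine as morphisms), `W → Spec R` locally noetherian with a section `w` such that every point of `W` lies in a preconnected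
subset of `W` containing a point of `w`, and a rank-one `N` on `(X ⊗ Y) ⊗ W` trivial on `({x} × Y) ⊗ W`, on `(X × {y}) ⊗ W` and on
`(X ⊗ Y) × w`, GIVEN the seesaw closed subscheme `i : Z ↪ W` of `N` (`huniv`): `N ≅ pr_W^*𝓜` for a rank-one quasi-coherent `𝓜` on `W`.
[cite: MumfordAV1970, §6 (theorem of the cube and its proof) and §10 (p. 89)] [cite: GortzWedhorn2023, Lemma 24.72 (p. 409)] -/
theorem exists_iso_pullback_snd_of_faces_of_section (X Y W : SchemeOver R) [Flat X.hom] [Flat Y.hom] [IsProper X.hom]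
    [IsProper Y.hom] [GeometricallyIntegral X.hom] [GeometricallyIntegral Y.hom] [IsLocallyNoetherian W.left]
    (hStX : ∀ (T : SchemeOver R) (V : T.left.Opens), Function.Bijective ((CartesianMonoidalCategory.snd X T).left.app V))
    (hStY : ∀ (T : SchemeOver R) (V : T.left.Opens), Function.Bijective ((CartesianMonoidalCategory.snd Y T).left.app V))
    (x : 𝟙_ (SchemeOver R) ⟶ X) (y : 𝟙_ (SchemeOver R) ⟶ Y) [IsAffineHom x.left] [IsAffineHom y.left]
    (N : ((X ⊗ Y) ⊗ W).left.Modules) (hN : HasRank N 1) {Z : SchemeOver R} (i : Z ⟶ W) [IsClosedImmersion i.left]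
    (huniv : ∀ (S : SchemeOver R) (u : S ⟶ W), (∃ v : S ⟶ Z, v ≫ i = u) ↔
      ∃ (𝓜 : S.left.Modules) (_ : 𝓜.IsQuasicoherent) (_ : HasRank 𝓜 1),
        Nonempty ((Scheme.Modules.pullback ((X ⊗ Y) ◁ u).left).obj N ≅ (Scheme.Modules.pullback (snd (X ⊗ Y) S).left).obj 𝓜))
    (h₁ : Nonempty (unitModule _ ≅ (Scheme.Modules.pullback (((λ_ Y).inv ≫ x ▷ Y) ▷ W).left).obj N))
    (h₂ : Nonempty (unitModule _ ≅ (Scheme.Modules.pullback (((ρ_ X).inv ≫ X ◁ y) ▷ W).left).obj N))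
    (w : 𝟙_ (SchemeOver R) ⟶ W) (h₃ : Nonempty (unitModule _ ≅ (Scheme.Modules.pullback ((X ⊗ Y) ◁ w).left).obj N))
    (hconn : ∀ t : W.left, ∃ C : Set W.left, _root_.IsPreconnected C ∧ t ∈ C ∧ ∃ s : (𝟙_ (SchemeOver R)).left, w.left.base s ∈ C) :
    ∃ (𝓜 : W.left.Modules) (_ : 𝓜.IsQuasicoherent) (_ : HasRank 𝓜 1),
      Nonempty (N ≅ (Scheme.Modules.pullback (snd (X ⊗ Y) W).left).obj 𝓜) := by
  -- the section factors through `Z`, so the image of `i` meets every `C`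
  obtain ⟨v, hv⟩ := exists_fac_of_nonempty_unit_iso (X ⊗ Y) W N i huniv w h₃
  have hw : ∀ s : (𝟙_ (SchemeOver R)).left, w.left.base s ∈ Set.range i.left.base := fun s =>
    ⟨v.left.base s, by rw [← hv]; rfl⟩
  -- at the points of `Z` the fibre is trivial, hence (Step (I)) all infinitesimal neighbourhoods factor through `Z`
  have hfib : ∀ t ∈ Set.range i.left.base, Nonempty (unitModule _ ≅ (Scheme.Modules.pullback ((X ⊗ Y) ◁
      (Over.homMk (W.left.fromSpecResidueField t) rfl : Over.mk (W.left.fromSpecResidueField t ≫ W.hom) ⟶ W)).left).obj N) :=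
    fun t ht => nonempty_unit_iso_fibre_of_mem_range (X ⊗ Y) W N i huniv t ht
  have hfac : ∀ t ∈ Set.range i.left.base, ∀ n : ℕ,
      ∃ v : Spec (.of (W.left.presheaf.stalk t ⧸ maximalIdeal (W.left.presheaf.stalk t) ^ (n + 1))) ⟶ Z.left,
        v ≫ i.left = Spec.map (CommRingCat.ofHom (Ideal.Quotient.mk (maximalIdeal (W.left.presheaf.stalk t) ^ (n + 1)))) ≫
          W.left.fromSpecStalk t := by
    intro t ht n
    have key := nonempty_unit_iso_infinitesimal X Y W x y t (surjective_toSectionsBase_stalk_of_univStein X W hStX t)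
      (surjective_toSectionsBase_stalk_of_univStein Y W hStY t) N hN h₁ h₂ (hfib t ht) n _ rfl
    obtain ⟨v, hv⟩ := exists_fac_of_nonempty_unit_iso (X ⊗ Y) W N i huniv _ key
    exact ⟨v.left, congrArg CommaMorphism.left hv⟩
  -- `Z = W` set-theoretically (open and closed, connected fibres through the section), hence every fibre is trivial: ★ γ0
  have hall : ∀ t : W.left, t ∈ Set.range i.left.base :=
    IsClosedImmersion.mem_range_of_forall_infinitesimal_factors_of_isPreconnected i.left hfac fun t => by
      obtain ⟨C, hC, htC, s, hs⟩ := hconn t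
      exact ⟨C, hC, htC, _, hs, hw s⟩
  exact exists_iso_pullback_snd_of_faces_of_fibres X Y W hStX hStY x y N hN i huniv h₁ h₂ fun t => hfib t (hall t)

end Literature.AlgebraicGeometry.Motives

end
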